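import Mathlib
import HarnessLib
import Summits.HubbardSuperconductivity.HubbardSuperconductivity.Theorems.KLProgrammeKLRegimeEngineTowerLevBridgeRhoWt

/-!
# Route `KLProgramme` — crux K3 ENGINE (stmt-HubbardSuperconductivity-20437 `KLRegimeEngineV17F2`), stub (b) v2, THE LEVELS PACKAGE (ℓ), located-risk #10
# cure (ε), instantiation (I)/(9): the SWAPPED door input in the SECTOR-DEPENDENT-PIN shape `x_t = y(σ_t)` of the oriented sectorised bridge
# (`SectorisedKernelNormOrientedBridge.exists_sectorSum_bound_kernel_sectorPreimage_of_wt_swPrescribedSum_le`, k3c2-p3 g13, hypothesis `hB′`) —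
# discharged from the STANDARD door input for a conserving polynomial (cell gate-hubbard-kl, seat hubbard-kl-k3c3-p2 g15)

k3c2-p3's oriented sectorised bridge asks the swapped input as: for every leg set `E` with `|E| = Fc`, free leg `t ∉ E`, prescription `τ` and EVERY choice
`y : sector → position` of the pin per sector of the pinned leg, `ε_x^m Σ_{σ|_E = τ|_E} Σ_{x : x_t = y(σ_t)} wl((x_i,σ_i)_i)·‖W_{F,σ}(x)‖ ≤ B′`.  For a frequency– and
momentum-conserving polynomial and a translation-invariant weight the pin's position is immaterial, so this follows from the STANDARD input bound
(`p ∈ E`, `|E| = Fc + 1`, fixed pin) ONE LEVEL LOWER; at level `0` (`E = ∅`) it follows from the standard bound at `|E| = 1` with the crude count `|Sec|`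
(no conservation needed).

* §1 generic transformers (any family `F`, any `G`, any label-set weight `wl`): **`swSigmaInput_of_stdInput`** (`|E| = Fc + 1`; needs the translation
  invariance of `wl·‖W‖`), **`swSigmaInput_levelZero_of_stdInput`** (`|E| = 0`; unconditional, bound `|Sec|·B`);
* §2 model instances at the thin family `F_J` for a conserving `T` (`0 < β`): weight `klScaleWt … j ∘ latticeLegPos` (`…_klScaleWt`) and the trivial weight
  (`…_unweighted`); tower form for the block input `𝒱_{dk}` at `F_{dk−1}` (`…_klTowerInput`).
Proofs only; nothing about the model is asserted; nothing asserts (ℓ), any stub, K3 or superconductivity.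
References: BGM 2006 §2.3 (2.17), §2.8 (2.88)–(2.90), App. A4 (A4.8) [cite: BenfattoGiulianiMastropietro2006].
-/

noncomputable section

namespace Summit.HubbardSuperconductivity.HubbardSuperconductivity.Theorems.EngineV8

set_option linter.dupNamespace false -- summit = problem name (single-conjunct summit), D-0017

open Classical
open Real Finset Literature.MathematicalPhysics.QuantumLattice Literature.Probability.LatticeModels GrassmannAlgebra
open Literature.MathematicalPhysics.QuantumLattice.FermiRG
open Summit.HubbardSuperconductivity.HubbardSuperconductivity.Theorems.KLRegimeSplit
open Summit.HubbardSuperconductivity.HubbardSuperconductivity.Theorems.KLProgrammeLegKernels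
open Summit.HubbardSuperconductivity.HubbardSuperconductivity.Theorems.DispersionFlow
open Summit.HubbardSuperconductivity.HubbardSuperconductivity.Theorems.KLRegimeWick

variable {L M : ℕ} [NeZero L] [NeZero M]

/-! ## §1 Generic transformers -/

/-- **THE SECTOR-DEPENDENT-PIN SWAPPED INPUT FROM THE STANDARD INPUT, ONE LEVEL LOWER** (any family `F`, any `G`, any weight `wl`, provided the weighted
summand is translation invariant in the positions): if `ε^m Σ_{σ|_E = τ|_E} Σ_{x_p = y} wl·‖W_σ(x)‖ ≤ B` for all `E ∋ p` with `|E| = Fc + 1`, then for every `E` with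
`|E| = Fc + 1`, every leg `t`, every `τ` and every `y : sector → position`: `ε^m Σ_{σ|_E = τ|_E} Σ_{x : x_t = y(σ_t)} wl·‖W_σ(x)‖ ≤ B`.
[cite: BenfattoGiulianiMastropietro2006, App. A4 (A4.8)] -/
theorem swSigmaInput_of_stdInput {N : ℕ} {β : ℝ} (F : Fin N → FreqMomentum L M → ℂ) (G : HubbardGrassmann L M)
    (wl : Finset (SpaceTimeIdx L M × SectorLeg N) → ℝ) {m : ℕ}
    (htr : ∀ (σ : Fin (m + 1) → SectorLeg N) (x : Fin (m + 1) → SpaceTimeIdx L M) (a : SpaceTimeIdx L M),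
      wl (univ.image fun i => ((x i + a, σ i) : SpaceTimeIdx L M × SectorLeg N)) * ‖sectorisedKernel L M β F G (m + 1) σ (fun i => x i + a)‖ =
        wl (univ.image fun i => ((x i, σ i) : SpaceTimeIdx L M × SectorLeg N)) * ‖sectorisedKernel L M β F G (m + 1) σ x‖)
    {Fc : ℕ} {B : ℝ}
    (hB : ∀ (E : Finset (Fin (m + 1))) (τ : Fin (m + 1) → SectorLeg N) (p : Fin (m + 1)), p ∈ E → E.card = Fc + 1 → ∀ y : SpaceTimeIdx L M,
      imagTimeWeight β M ^ m * ∑ σ ∈ univ.filter (fun σ : Fin (m + 1) → SectorLeg N => ∀ e ∈ E, σ e = τ e),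
        ∑ x ∈ univ.filter (fun x : Fin (m + 1) → SpaceTimeIdx L M => x p = y),
          wl (univ.image fun i => ((x i, σ i) : SpaceTimeIdx L M × SectorLeg N)) * ‖sectorisedKernel L M β F G (m + 1) σ x‖ ≤ B)
    (E : Finset (Fin (m + 1))) (τ : Fin (m + 1) → SectorLeg N) (t : Fin (m + 1)) (hE : E.card = Fc + 1) (yσ : SectorLeg N → SpaceTimeIdx L M) :
    imagTimeWeight β M ^ m * ∑ σ ∈ univ.filter (fun σ : Fin (m + 1) → SectorLeg N => ∀ e ∈ E, σ e = τ e),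
        ∑ x ∈ univ.filter (fun x : Fin (m + 1) → SpaceTimeIdx L M => x t = yσ (σ t)),
          wl (univ.image fun i => ((x i, σ i) : SpaceTimeIdx L M × SectorLeg N)) * ‖sectorisedKernel L M β F G (m + 1) σ x‖ ≤ B := by
  haveI : NeZero (2 * M) := ⟨by have := NeZero.ne M; omega⟩
  rw [sum_congr rfl fun σ _ => sum_filter_apply_eq_of_translate
    (fun x => wl (univ.image fun i => ((x i, σ i) : SpaceTimeIdx L M × SectorLeg N)) * ‖sectorisedKernel L M β F G (m + 1) σ x‖)
    (htr σ) t t (yσ (σ t)) 0]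
  exact sum_posPinned_prescribedSum_le_of_prescribedSum_le
    (fun σ x => wl (univ.image fun i => ((x i, σ i) : SpaceTimeIdx L M × SectorLeg N)) * ‖sectorisedKernel L M β F G (m + 1) σ x‖) htr hB E τ hE t 0

omit [NeZero M] in
/-- **THE SECTOR-DEPENDENT-PIN SWAPPED INPUT AT LEVEL `0`** (unconditional): if `ε^m Σ_{σ|_E = τ|_E} Σ_{x_p = y} wl·‖W_σ(x)‖ ≤ B` for all `E ∋ p` with `|E| = 1`, then
for `|E| = 0`, every leg `t`, `τ`, `y : sector → position`: `ε^m Σ_{σ|_E = τ|_E} Σ_{x : x_t = y(σ_t)} wl·‖W_σ(x)‖ ≤ |SectorLeg N|·B` (split over `σ_t`; each fibre is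
a standard input with `E = {t}`). -/
theorem swSigmaInput_levelZero_of_stdInput {N : ℕ} {β : ℝ} (F : Fin N → FreqMomentum L M → ℂ) (G : HubbardGrassmann L M)
    (wl : Finset (SpaceTimeIdx L M × SectorLeg N) → ℝ) {m : ℕ} {B : ℝ}
    (hB : ∀ (E : Finset (Fin (m + 1))) (τ : Fin (m + 1) → SectorLeg N) (p : Fin (m + 1)), p ∈ E → E.card = 0 + 1 → ∀ y : SpaceTimeIdx L M,
      imagTimeWeight β M ^ m * ∑ σ ∈ univ.filter (fun σ : Fin (m + 1) → SectorLeg N => ∀ e ∈ E, σ e = τ e),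
        ∑ x ∈ univ.filter (fun x : Fin (m + 1) → SpaceTimeIdx L M => x p = y),
          wl (univ.image fun i => ((x i, σ i) : SpaceTimeIdx L M × SectorLeg N)) * ‖sectorisedKernel L M β F G (m + 1) σ x‖ ≤ B)
    (E : Finset (Fin (m + 1))) (τ : Fin (m + 1) → SectorLeg N) (t : Fin (m + 1)) (hE : E.card = 0) (yσ : SectorLeg N → SpaceTimeIdx L M) :
    imagTimeWeight β M ^ m * ∑ σ ∈ univ.filter (fun σ : Fin (m + 1) → SectorLeg N => ∀ e ∈ E, σ e = τ e),
        ∑ x ∈ univ.filter (fun x : Fin (m + 1) → SpaceTimeIdx L M => x t = yσ (σ t)),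
          wl (univ.image fun i => ((x i, σ i) : SpaceTimeIdx L M × SectorLeg N)) * ‖sectorisedKernel L M β F G (m + 1) σ x‖ ≤
      Fintype.card (SectorLeg N) * B := by
  have hE0 : E = ∅ := card_eq_zero.1 hE
  subst hE0
  set f : (Fin (m + 1) → SectorLeg N) → ℝ := fun σ =>
    ∑ x ∈ univ.filter (fun x : Fin (m + 1) → SpaceTimeIdx L M => x t = yσ (σ t)),
      wl (univ.image fun i => ((x i, σ i) : SpaceTimeIdx L M × SectorLeg N)) * ‖sectorisedKernel L M β F G (m + 1) σ x‖ with hf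
  have hsplit : ∑ σ ∈ univ.filter (fun σ : Fin (m + 1) → SectorLeg N => ∀ e ∈ (∅ : Finset (Fin (m + 1))), σ e = τ e), f σ =
      ∑ s₀ : SectorLeg N, ∑ σ ∈ univ.filter (fun σ : Fin (m + 1) → SectorLeg N => ∀ e ∈ ({t} : Finset (Fin (m + 1))), σ e = (fun _ => s₀) e), f σ := by
    have huniv : univ.filter (fun σ : Fin (m + 1) → SectorLeg N => ∀ e ∈ (∅ : Finset (Fin (m + 1))), σ e = τ e) = univ := by
      ext σ; simp
    rw [huniv, ← Finset.sum_fiberwise univ (fun σ : Fin (m + 1) → SectorLeg N => σ t) f]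
    refine sum_congr rfl fun s₀ _ => sum_congr ?_ fun _ _ => rfl
    ext σ
    simp
  rw [hsplit, mul_sum]
  calc ∑ s₀ : SectorLeg N, imagTimeWeight β M ^ m *
        ∑ σ ∈ univ.filter (fun σ : Fin (m + 1) → SectorLeg N => ∀ e ∈ ({t} : Finset (Fin (m + 1))), σ e = (fun _ => s₀) e), f σ
      ≤ ∑ _s₀ : SectorLeg N, B := by
        refine sum_le_sum fun s₀ _ => ?_
        have hfib : ∑ σ ∈ univ.filter (fun σ : Fin (m + 1) → SectorLeg N => ∀ e ∈ ({t} : Finset (Fin (m + 1))), σ e = (fun _ => s₀) e), f σ =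
            ∑ σ ∈ univ.filter (fun σ : Fin (m + 1) → SectorLeg N => ∀ e ∈ ({t} : Finset (Fin (m + 1))), σ e = (fun _ => s₀) e),
              ∑ x ∈ univ.filter (fun x : Fin (m + 1) → SpaceTimeIdx L M => x t = yσ s₀),
                wl (univ.image fun i => ((x i, σ i) : SpaceTimeIdx L M × SectorLeg N)) * ‖sectorisedKernel L M β F G (m + 1) σ x‖ := by
          refine sum_congr rfl fun σ hσ => ?_
          have hσt : σ t = s₀ := (mem_filter.1 hσ).2 t (mem_singleton_self t)
          simp only [hf, hσt]
        rw [hfib]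
        exact hB {t} (fun _ => s₀) t (mem_singleton_self t) (by rw [card_singleton]) (yσ s₀)
    _ = Fintype.card (SectorLeg N) * B := by rw [sum_const, card_univ, nsmul_eq_mul]

/-! ## §2 Model instances -/

/-- **MODEL, conserving `T` at the thin family `F_J`, weight `klScaleWt … j ∘ latticeLegPos`** (`0 < β`): the standard weighted input bound at `|E| = Fc + 1 ∋ p`
gives k3c2-p3's sector-dependent-pin swapped bound at `|E| = Fc + 1`, any leg, any `y : sector → position`. [cite: BenfattoGiulianiMastropietro2006, App. A4 (A4.8)] -/
theorem swSigmaInput_of_stdInput_klScaleWt {β : ℝ} (hβ : 0 < β) (μ : ℝ) (K : TrigPolyC4v) (J j : ℕ) (T : HubbardGrassmann L M)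
    (hTf : ∀ (m : ℕ) (X : Fin m → HubbardFieldIdx L M),
      (∑ i, (if (X i).2 = 0 then (1 : ℤ) else -1) * matsubaraInt M (X i).1.1.1) ≠ 0 → kernel ℂ T m X = 0)
    (hT : ∀ (m : ℕ) (X : Fin m → HubbardFieldIdx L M), ∑ i, signedMomentum L (X i).2 (X i).1.1.2 ≠ 0 → kernel ℂ T m X = 0)
    {m Fc : ℕ} {B : ℝ}
    (hB : ∀ (E : Finset (Fin (m + 1))) (τ : Fin (m + 1) → SectorLeg (sectorCount J)) (p : Fin (m + 1)), p ∈ E → E.card = Fc + 1 →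
      ∀ y : SpaceTimeIdx L M,
        imagTimeWeight β M ^ m * ∑ σ ∈ univ.filter (fun σ : Fin (m + 1) → SectorLeg (sectorCount J) => ∀ e ∈ E, σ e = τ e),
          ∑ x ∈ univ.filter (fun x : Fin (m + 1) → SpaceTimeIdx L M => x p = y),
            klScaleWt L M β j ((univ.image fun i => ((x i, σ i) : SpaceTimeIdx L M × SectorLeg (sectorCount J))).image (latticeLegPos (2 * (2 * M)))) *
              ‖sectorisedKernel L M β (klAnisoFamily L M β μ K klE0 J) T (m + 1) σ x‖ ≤ B)
    (E : Finset (Fin (m + 1))) (τ : Fin (m + 1) → SectorLeg (sectorCount J)) (t : Fin (m + 1)) (hE : E.card = Fc + 1)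
    (yσ : SectorLeg (sectorCount J) → SpaceTimeIdx L M) :
    imagTimeWeight β M ^ m * ∑ σ ∈ univ.filter (fun σ : Fin (m + 1) → SectorLeg (sectorCount J) => ∀ e ∈ E, σ e = τ e),
        ∑ x ∈ univ.filter (fun x : Fin (m + 1) → SpaceTimeIdx L M => x t = yσ (σ t)),
          klScaleWt L M β j ((univ.image fun i => ((x i, σ i) : SpaceTimeIdx L M × SectorLeg (sectorCount J))).image (latticeLegPos (2 * (2 * M)))) *
            ‖sectorisedKernel L M β (klAnisoFamily L M β μ K klE0 J) T (m + 1) σ x‖ ≤ B :=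
  swSigmaInput_of_stdInput (klAnisoFamily L M β μ K klE0 J) T
    (fun S => klScaleWt L M β j (S.image (latticeLegPos (2 * (2 * M))))) (fun σ x a => wtNorm_translate hβ.ne' _ T hTf hT j (m + 1) σ x a)
    hB E τ t hE yσ

/-- **MODEL, conserving `T` at the thin family `F_J`, NO weight** (`0 < β`): the same with the summand `‖W_σ(x)‖`. -/
theorem swSigmaInput_of_stdInput_unweighted {β : ℝ} (hβ : 0 < β) (μ : ℝ) (K : TrigPolyC4v) (J : ℕ) (T : HubbardGrassmann L M)
    (hTf : ∀ (m : ℕ) (X : Fin m → HubbardFieldIdx L M),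
      (∑ i, (if (X i).2 = 0 then (1 : ℤ) else -1) * matsubaraInt M (X i).1.1.1) ≠ 0 → kernel ℂ T m X = 0)
    (hT : ∀ (m : ℕ) (X : Fin m → HubbardFieldIdx L M), ∑ i, signedMomentum L (X i).2 (X i).1.1.2 ≠ 0 → kernel ℂ T m X = 0)
    {m Fc : ℕ} {B : ℝ}
    (hB : ∀ (E : Finset (Fin (m + 1))) (τ : Fin (m + 1) → SectorLeg (sectorCount J)) (p : Fin (m + 1)), p ∈ E → E.card = Fc + 1 →
      ∀ y : SpaceTimeIdx L M,
        imagTimeWeight β M ^ m * ∑ σ ∈ univ.filter (fun σ : Fin (m + 1) → SectorLeg (sectorCount J) => ∀ e ∈ E, σ e = τ e),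
          ∑ x ∈ univ.filter (fun x : Fin (m + 1) → SpaceTimeIdx L M => x p = y),
            ‖sectorisedKernel L M β (klAnisoFamily L M β μ K klE0 J) T (m + 1) σ x‖ ≤ B)
    (E : Finset (Fin (m + 1))) (τ : Fin (m + 1) → SectorLeg (sectorCount J)) (t : Fin (m + 1)) (hE : E.card = Fc + 1)
    (yσ : SectorLeg (sectorCount J) → SpaceTimeIdx L M) :
    imagTimeWeight β M ^ m * ∑ σ ∈ univ.filter (fun σ : Fin (m + 1) → SectorLeg (sectorCount J) => ∀ e ∈ E, σ e = τ e),
        ∑ x ∈ univ.filter (fun x : Fin (m + 1) → SpaceTimeIdx L M => x t = yσ (σ t)),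
          ‖sectorisedKernel L M β (klAnisoFamily L M β μ K klE0 J) T (m + 1) σ x‖ ≤ B := by
  haveI : NeZero (2 * M) := ⟨by have := NeZero.ne M; omega⟩
  have h := swSigmaInput_of_stdInput (klAnisoFamily L M β μ K klE0 J) T (fun _ => (1 : ℝ)) (m := m)
    (fun σ x a => by rw [one_mul, one_mul]; exact norm_sectorisedKernel_translate hβ.ne' _ T hTf hT (m + 1) σ x a)
    (Fc := Fc) (B := B) (fun E' τ' p hp hE' y => by simpa only [one_mul] using hB E' τ' p hp hE' y) E τ t hE yσ
  simpa only [one_mul] using h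

/-- **TOWER FORM**: for the block input `𝒱_{dk}` at `F_{dk−1}` (conserving), weight `klScaleWt … j ∘ latticeLegPos`, the standard weighted input bound at
`|E| = Fc + 1 ∋ p` gives the sector-dependent-pin swapped bound at `|E| = Fc + 1` (`0 < β`). -/
theorem swSigmaInput_of_stdInput_klTowerInput {β : ℝ} (hβ : 0 < β) (U μ : ℝ) (K : TrigPolyC4v) (d k j : ℕ) {m Fc : ℕ} {B : ℝ}
    (hB : ∀ (E : Finset (Fin (m + 1))) (τ : Fin (m + 1) → SectorLeg (sectorCount (d * k - 1))) (p : Fin (m + 1)), p ∈ E → E.card = Fc + 1 →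
      ∀ y : SpaceTimeIdx L M,
        imagTimeWeight β M ^ m * ∑ σ ∈ univ.filter (fun σ : Fin (m + 1) → SectorLeg (sectorCount (d * k - 1)) => ∀ e ∈ E, σ e = τ e),
          ∑ x ∈ univ.filter (fun x : Fin (m + 1) → SpaceTimeIdx L M => x p = y),
            klScaleWt L M β j ((univ.image fun i => ((x i, σ i) : SpaceTimeIdx L M × SectorLeg (sectorCount (d * k - 1)))).image
              (latticeLegPos (2 * (2 * M)))) *
              ‖sectorisedKernel L M β (klAnisoFamily L M β μ K klE0 (d * k - 1)) (klTowerInput L M β U μ K d k) (m + 1) σ x‖ ≤ B)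
    (E : Finset (Fin (m + 1))) (τ : Fin (m + 1) → SectorLeg (sectorCount (d * k - 1))) (t : Fin (m + 1)) (hE : E.card = Fc + 1)
    (yσ : SectorLeg (sectorCount (d * k - 1)) → SpaceTimeIdx L M) :
    imagTimeWeight β M ^ m * ∑ σ ∈ univ.filter (fun σ : Fin (m + 1) → SectorLeg (sectorCount (d * k - 1)) => ∀ e ∈ E, σ e = τ e),
        ∑ x ∈ univ.filter (fun x : Fin (m + 1) → SpaceTimeIdx L M => x t = yσ (σ t)),
          klScaleWt L M β j ((univ.image fun i => ((x i, σ i) : SpaceTimeIdx L M × SectorLeg (sectorCount (d * k - 1)))).image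
            (latticeLegPos (2 * (2 * M)))) *
            ‖sectorisedKernel L M β (klAnisoFamily L M β μ K klE0 (d * k - 1)) (klTowerInput L M β U μ K d k) (m + 1) σ x‖ ≤ B :=
  swSigmaInput_of_stdInput_klScaleWt hβ μ K (d * k - 1) j (klTowerInput L M β U μ K d k)
    (fun _ _ hX => kernel_klEffectiveAction_eq_zero_of_freq β U μ K klE0 (d * k) hX)
    (fun m' X hX => klEffectiveAction_momentumConserving β U μ K klE0 (d * k) m' X hX) hB E τ t hE yσ

/-- **TOWER FORM, UNWEIGHTED, against the measured levelled array**: the sector-dependent-pin swapped input of `𝒱_{dk}` at `F_{dk−1}` with `|E| = Fc + 1` is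
`≤ klTowerMeasLev L M β U μ K d k (m+1) Fc` (`0 < β`) — k3c2-p3's `hB′` at level `Fc + 1` read ONE LEVEL LOWER. -/
theorem swSigmaInput_klTowerInput_le_klTowerMeasLev {β : ℝ} (hβ : 0 < β) (U μ : ℝ) (K : TrigPolyC4v) (d k : ℕ) {m Fc : ℕ}
    (E : Finset (Fin (m + 1))) (τ : Fin (m + 1) → SectorLeg (sectorCount (d * k - 1))) (t : Fin (m + 1)) (hE : E.card = Fc + 1)
    (yσ : SectorLeg (sectorCount (d * k - 1)) → SpaceTimeIdx L M) :
    imagTimeWeight β M ^ m * ∑ σ ∈ univ.filter (fun σ : Fin (m + 1) → SectorLeg (sectorCount (d * k - 1)) => ∀ e ∈ E, σ e = τ e),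
        ∑ x ∈ univ.filter (fun x : Fin (m + 1) → SpaceTimeIdx L M => x t = yσ (σ t)),
          ‖sectorisedKernel L M β (klAnisoFamily L M β μ K klE0 (d * k - 1)) (klTowerInput L M β U μ K d k) (m + 1) σ x‖ ≤
      klTowerMeasLev L M β U μ K d k (m + 1) Fc :=
  swSigmaInput_of_stdInput_unweighted hβ μ K (d * k - 1) (klTowerInput L M β U μ K d k)
    (fun _ _ hX => kernel_klEffectiveAction_eq_zero_of_freq β U μ K klE0 (d * k) hX)
    (fun m' X hX => klEffectiveAction_momentumConserving β U μ K klE0 (d * k) m' X hX)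
    (fun E' τ' p hp hE' y => doorInput_of_levelBounds hβ.le μ K (d * k - 1) (klTowerInput L M β U μ K d k)
      (fun m' X hX => klEffectiveAction_momentumConserving β U μ K klE0 (d * k) m' X hX)
      (fun F => klTowerMeasLev L M β U μ K d k (m + 1) F) (fun Ωe' => klLevNormOf_le_klTowerMeasLev β U μ K d k (m + 1) Ωe') Fc E' τ' p hp hE' y)
    E τ t hE yσ

/-- **TOWER FORM, UNWEIGHTED, LEVEL `0`**: with `|E| = 0` the sector-dependent-pin swapped input of `𝒱_{dk}` at `F_{dk−1}` is
`≤ |SectorLeg (sectorCount (dk−1))|·klTowerMeasLev L M β U μ K d k (m+1) 0` (`0 ≤ β`; unconditional). -/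
theorem swSigmaInput_klTowerInput_levelZero_le {β : ℝ} (hβ : 0 ≤ β) (U μ : ℝ) (K : TrigPolyC4v) (d k : ℕ) {m : ℕ}
    (E : Finset (Fin (m + 1))) (τ : Fin (m + 1) → SectorLeg (sectorCount (d * k - 1))) (t : Fin (m + 1)) (hE : E.card = 0)
    (yσ : SectorLeg (sectorCount (d * k - 1)) → SpaceTimeIdx L M) :
    imagTimeWeight β M ^ m * ∑ σ ∈ univ.filter (fun σ : Fin (m + 1) → SectorLeg (sectorCount (d * k - 1)) => ∀ e ∈ E, σ e = τ e),
        ∑ x ∈ univ.filter (fun x : Fin (m + 1) → SpaceTimeIdx L M => x t = yσ (σ t)),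
          ‖sectorisedKernel L M β (klAnisoFamily L M β μ K klE0 (d * k - 1)) (klTowerInput L M β U μ K d k) (m + 1) σ x‖ ≤
      Fintype.card (SectorLeg (sectorCount (d * k - 1))) * klTowerMeasLev L M β U μ K d k (m + 1) 0 := by
  have h := swSigmaInput_levelZero_of_stdInput (klAnisoFamily L M β μ K klE0 (d * k - 1)) (klTowerInput L M β U μ K d k) (fun _ => (1 : ℝ))
    (m := m) (B := klTowerMeasLev L M β U μ K d k (m + 1) 0)
    (fun E' τ' p hp hE' y => by
      simpa only [one_mul] using doorInput_of_levelBounds hβ μ K (d * k - 1) (klTowerInput L M β U μ K d k)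
        (fun m' X hX => klEffectiveAction_momentumConserving β U μ K klE0 (d * k) m' X hX)
        (fun F => klTowerMeasLev L M β U μ K d k (m + 1) F) (fun Ωe' => klLevNormOf_le_klTowerMeasLev β U μ K d k (m + 1) Ωe') 0 E' τ' p hp hE' y)
    E τ t hE yσ
  simpa only [one_mul] using h

end Summit.HubbardSuperconductivity.HubbardSuperconductivity.Theorems.EngineV8
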